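import Summits.BirchSwinnertonDyer.BirchSwinnertonDyer.Theorems.ByReductionTypeAtTwoOrdKatoOptimalLedger
import Summits.BirchSwinnertonDyer.BirchSwinnertonDyer.Theorems.ByReductionTypeAtTwoAnalyticMuZeroShapes
import Summits.BirchSwinnertonDyer.BirchSwinnertonDyer.Theorems.ByReductionTypeAtTwoOrdKatoHalfAtTwoIsoHintOfAbbesUllmo
import Summits.BirchSwinnertonDyer.Rank1Residual.X10.CoreTheoremAOddPrime
import Summits.BirchSwinnertonDyer.Rank1Residual.X5.KatoOrdTwoMuPart
import Summits.BirchSwinnertonDyer.Rank1Residual.X5.TwoAdicImageCriteriaLift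
import Literature.NumberTheory.EllipticCurves.Kato2004.EulerSystemBoundFineSelmerTwo
import Literature.NumberTheory.EllipticCurves.TwoAdicImageGoodOrdinaryAtTwoProofs
import Literature.NumberTheory.EllipticCurves.PAdicLFunctionIntegralityAtTwoAutoProofs
import Literature.NumberTheory.EllipticCurves.NonEisensteinPrimeOfSurjective
import HarnessLib

/-!
# Route ByReductionTypeAtTwo, crux `OrdKatoHalfAtTwoIso` (stmt-BirchSwinnertonDyer-19573), line
# `steinberg-fibre-at-two`: the two OPEN residue sockets as DISPLAYED binders (Theorems-side definitions)
# and the KERNEL composition «sockets ⇒ μ(X(E/ℚ_∞)) = 0 on the DD12 residue ⇒ the residue binder ⇒ the crux»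

Seat `cruxlead-stmt-BirchSwinnertonDyer-19573-g0` (LEAD PROVER, MODE LINE; HOME `run/shared/lean/pub/bsd-2adic/`;
pen rulings RC-285/RC-290, PEN-PICK-19573-r1 ADD-8/ADD-9). HONEST FRAMING (cell bsd-2adic): BSD is not proved by any
of this; the crux `OrdKatoHalfAtTwoIso` is NOT proved here; the two definitions below are OPEN statements DISPLAYED
BY NAME (one research statement, one memo-tier reading), nothing is asserted about them, and every theorem of this
file is CONDITIONAL on the displayed binders it names. Pattern of the cell's binder files
`ByReductionTypeAtTwoOrdKatoIntDefs.lean` / `…OrdKatoOptimalDefs.lean` (B8 / B7): the registered skeleton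
`Cruxes/OrdKatoHalfAtTwoIso/Lines/steinberg_fibre_at_two.lean` (v4) imports this module, so its stubs `stub_port`,
`stub_F1_two` are literally these constants and its composition is ONE application of `ordKatoHalfAtTwoIso_of_sockets`.

* `CoreTheoremATwoResidue` — **[research, OPEN] SOCKET 1 (`stub_port`, the LEVER)**: VERBATIM the tree's typed node
  `X10.CoreTheoremAOddPrime` (whose `_holds` is a kernel theorem at every ODD prime) with `p ≠ 2, Irr, ¬Surj` replaced
  by `p = 2`, `ρ̄_{E,2}` onto `GL₂(𝔽₂)`, `Δ < 0`, and the `p`-generic class predicate replaced by the tree's `p = 2`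
  spelling `Kato2004.IsEulerSystemClassTwo` (level `ℚ(μ_{2^{n+2}})`): a genuine `2`-adic Λ-adic Euler-system class
  `∉ 2·𝐇¹_Γ(T₂W)` ⇒ some iterate `(conj_γ − id)^J` kills every `E[2]`-lift of `Sel₀(E/ℚ_∞)`. Two candidate roads
  (cards `steinberg-fibre-at-two`: E-split port with (S) Steinberg projectivity of `E[2]`, (R) regularity of
  `𝔽₂[T]/(T^{2^k})`, (Δ) complex conjugation a transposition; `sign-blind-kolyvagin-primes`: rank-one transposition
  primes over `Ω = Λ/2`) — same `Prop` (`Iff.rfl` with card #9's `RankOneOmegaPortAtTwo`). NOT in print at `2`.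
* `DivisibilityInputsFineZetaAtTwoResidue` — **[MEMO tier] SOCKET 2 (`stub_F1_two`)**: Kato's §17.13 package
  `Kato2004.DivisibilityInputs W 2 f κ γ I D` AT `p = 2` on the DD12 residue (non-CM, good ordinary at `2`, `ρ̄₂` onto,
  `ρ_{2^∞}` NOT onto — so the big-image field `integral` = Thm. 12.5 (4)/17.4 (3), printed for `p ≠ 2`, is VACUOUS:
  `integral_hypothesis_false_of_not_twoAdicSurjective`), with the fine quotient `π : X ↠ X₀` and the Thm. 12.6 span
  clause over genuine `2`-adic classes, `𝐇¹_Γ` bundled. Keyed to the cell delta-memo **MEMO-5′**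
  (`HOME/bsd-2adic-cruxlead19573-MEMO-5PRIME.md` @c7235a6f37ab26bc: MEMO-5's Poitou–Tate / Coleman / period
  bookkeeping at `2` — Δ2, Δ7, Δ8, Δ9, §3.1–3.3 — WITHOUT its Euler-system engine and WITHOUT (S2∞), field by field;
  real places invisible because `Δ < 0` on the residue; Thm. 13.4 (2)/12.5 (3) at `𝔭 ∌ 2` under the RATIONAL condition
  (v); D-audit by audit-2 requested per RC-290). A READING of Kato §§12–17 at `2`; NOT in print as stated (Kato's Conj.
  12.10 itself is formulated at `p = 2` only off the prime `(2)`); NOT a Literature fact; NO-OFFER until audited.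
* `coreTheoremATwoResidue_iff`, `divisibilityInputsFineZetaAtTwoResidue_iff` — the constants unfold to their bodies.
* `integral_hypothesis_false_of_not_twoAdicSurjective` — kernel: on the residue the hypothesis of
  `DivisibilityInputs.integral` is refutable (`O1.TwoAdicSurjective W` is `∀ n > 0, ρ̄_{2^n}` onto).
* `mu_eq_zero_on_residue_of_sockets` — **KERNEL modulo the two sockets: `μ(X(E/ℚ_∞)) = 0` for every cyclotomic Selmer
  dual datum of a residue curve** — the verbatim `p = 2` twin of `X10.mu_eq_zero_of_coreOddPrime` over the generic-`p`
  tree lemmas (`exists_mem_zeta_not_mem_of_mu_eq_zero`, `exists_mem_not_mem_of_le_span`, `lengthAt_X_le_lengthAt_fine`,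
  `finite_fineSelmerInfty_pTorsion_of_forall_iterate_eq_zero`, `KatoMuSkeleton.lengthAt_eq_zero_of_finite_quotient_p`,
  `muInvariant_eq_toNat_lengthAt`), INT2-AUTO, socket 3 CLOSED (`AnalyticMuTwo.analyticMuZeroFOnDD12Residue_shape`,
  p642753) and the Dokchitser–Dokchitser sign `Δ < 0` (`Δ_neg_of_residue'`).
* `ordKatoHalfDD12ResidueTwo_of_sockets` — + Abbes–Ullmo BY NAME (socket 4, p654400) + Kato 17.4 (1)(2) at `2` (`h17`)
  ⇒ the cell's residue binder `OrdKatoOptimalAtTwo.OrdKatoHalfDD12ResidueTwo`.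
* `ordKatoHalfAtTwoIso_of_sockets` — + B7, B8 ⇒ **the crux `OrdKatoHalfAtTwoIso` BY NAME** through the cell's door
  `ordKatoHalfAtTwoIso_of_binders`: after this file the crux is open EXACTLY on {socket 1 (research), socket 2 (memo),
  B7, B8 (memo), Abbes–Ullmo + Kato 17.4 (1)(2) (print)}.

References: [Kato2004Asterisque] Thm 12.4, 12.5, 12.6, §13.8, (14.9.3), 16.6, 17.4, 17.11, §17.13;
[MazurTateTeitelbaum1986Invent] §I.12; [DokchitserDokchitserMathZ2012]; [AbbesUllmo1996] Thm A; [GreenbergLNM1716]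
Conj 1.11, pp. 170–172; cards `Cruxes/OrdKatoHalfAtTwoIso/Ideas/{steinberg-fibre-at-two, sign-blind-kolyvagin-primes}.md`;
MEMO-5 / MEMO-5′ (HOME).
-/

set_option autoImplicit false
set_option linter.dupNamespace false

noncomputable section

open scoped Classical MatrixGroups ModularForm NumberField
open CongruenceSubgroup WeierstrassCurve Field IsDedekindDomain
open Literature.NumberTheory.GaloisRepresentations
open Literature.NumberTheory.EllipticCurves Literature.NumberTheory.EllipticCurves.ModularForms
open Literature.NumberTheory.EllipticCurves.Kato2004
  Literature.NumberTheory.EllipticCurves.Kato2004.EulerSystemValues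
open Literature.NumberTheory.EllipticCurves.Rank1Residual
open Summit.BirchSwinnertonDyer.BirchSwinnertonDyer.Theorems.Rank1ResidualX1Defs
  Summit.BirchSwinnertonDyer.BirchSwinnertonDyer.Rank1Residual
open Summit.BirchSwinnertonDyer.Rank1Residual Summit.BirchSwinnertonDyer.Rank1Residual.X5
open Summit.BirchSwinnertonDyer.BirchSwinnertonDyer.Theorems.OrdKatoOptimalAtTwo
  Summit.BirchSwinnertonDyer.BirchSwinnertonDyer.Theorems.OrdKatoIntAtTwo
open Summit.BirchSwinnertonDyer.BirchSwinnertonDyer.Theses.ByReductionTypeAtTwo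

namespace Summit.BirchSwinnertonDyer.BirchSwinnertonDyer.Theorems.SteinbergFibreAtTwo

/-! ## §1 The two OPEN residue sockets, displayed by name -/

/-- [research, OPEN] **SOCKET 1 of line `steinberg-fibre-at-two` — the Ω = Λ/2 port.** For `W/ℚ` globally
minimal elliptic, good ordinary at `2`, `ρ̄_{E,2}` onto `GL₂(𝔽₂)`, `Δ < 0`, the cyclotomic `(κ, γ)` and Kato's
`𝐇¹_Γ(T₂W)` (`I`): if some GENUINE `2`-adic Λ-adic Euler-system class `s ∈ 𝐇¹` (`IsEulerSystemClassTwo W hκ I s`)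
is not divisible by `2`, then some iterate `(conj_γ − id)^[J]` kills every `y ∈ H¹(ℚ_∞, E[2])` whose image lies
in `Sel₀(ℚ_∞, E[2^∞])`. VERBATIM `X10.CoreTheoremAOddPrime` with `p ≠ 2, Irr, ¬Surj ↦ p = 2, Surj(2), Δ < 0` and
the `p = 2` class predicate. OPEN; NOT in print at `2`; nothing asserted.
[cite: Kato2004Asterisque, Thm. 12.6 (p. 222), §13.8 (p. 228) (shape only; nothing asserted)] -/
@[conjecture] def CoreTheoremATwoResidue : Prop :=
  ∀ (W : WeierstrassCurve ℚ) [W.IsElliptic] [W.IsGloballyMinimal]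
    [ContinuousSMul ℤ_[2] (W.tateModule 2)] [Module.Free ℤ_[2] (W.tateModule 2)]
    [Module.Finite ℤ_[2] (W.tateModule 2)]
    (κ : ZpExtension ℚ 2) (γ : absoluteGaloisGroup ℚ) (I : IwasawaH1Data W 2 κ γ)
    (hκ : κ.IsCyclotomic),
    W.HasGoodReductionAtPrime 2 → ¬ (2 : ℤ) ∣ W.frobeniusTrace 2 →
    W.HasSurjectiveModNGaloisRep 2 → W.Δ < 0 → κ.IsTopGenerator γ →
    (∃ s : I.H, IsEulerSystemClassTwo W hκ I s ∧
      s ∉ IwasawaAlgebra.augIdealP 2 • (⊤ : Submodule (IwasawaAlgebra 2) I.H)) →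
    ∃ J : ℕ, ∀ y : Literature.NumberTheory.EllipticCurves.subgroupH1 κ.kerSubgroup
        (WeierstrassCurve.geomTorsion W (2 : ℤ)),
      W.torsionToPrimaryH1Sub 2 κ.kerSubgroup y ∈ W.fineSelmerInfty κ →
        (⇑(Literature.NumberTheory.EllipticCurves.conjH1 κ.kerSubgroup
            (WeierstrassCurve.geomTorsion W (2 : ℤ)) γ -
          AddMonoidHom.id (Literature.NumberTheory.EllipticCurves.subgroupH1 κ.kerSubgroup
            (WeierstrassCurve.geomTorsion W (2 : ℤ)))))^[J] y = 0

/-- [MEMO tier, OPEN] **SOCKET 2 of line `steinberg-fibre-at-two` — Kato's §17.13 package AT `p = 2` on the DD12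
residue**: for every non-CM globally minimal `W`, good ordinary at `2`, `ρ̄_{W,2}` onto, `ρ_{W,2^∞}` NOT onto
(so `Δ_W < 0` by Dokchitser–Dokchitser, and the big-image field `DivisibilityInputs.integral` is vacuous), its
newform `f`, the cyclotomic `(κ, γ)`: for every Selmer dual datum `D` and fine Selmer dual datum `Y` there are a
pinned `𝐇¹_Γ(T₂W)`, a package `K : DivisibilityInputs W 2 f κ γ I D` and a surjection `π : X ↠ X₀` exact after
`P → X`, with `K.Z` inside the Λ-span of GENUINE `2`-adic Euler-system classes. Keyed to the cell delta-memo
MEMO-5′ @c7235a6f37ab26bc (MEMO-5 Δ2/Δ7/Δ8/Δ9/§3.1–3.3 without the engine and without (S2∞); real places invisible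
at `Δ < 0`; 13.4 (2)/12.5 (3) off `(2)` under the rational condition (v)). A READING of Kato §§12–17 at `2`, NOT in
print as stated; NOT a Literature fact; nothing asserted.
[cite: Kato2004Asterisque, Thm. 12.4 (1) (p. 221), Thm. 12.6 (p. 222), Thm. 16.6 (p. 271), Prop. 17.11 (p. 277), §17.13 (pp. 279–280) (shape only; nothing asserted)] -/
@[conjecture] def DivisibilityInputsFineZetaAtTwoResidue : Prop :=
  ∀ (W : WeierstrassCurve ℚ) [W.IsElliptic] [W.IsGloballyMinimal]
    [ContinuousSMul ℤ_[2] (W.tateModule 2)] [Module.Free ℤ_[2] (W.tateModule 2)]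
    [Module.Finite ℤ_[2] (W.tateModule 2)] {N : ℕ} [NeZero N] (f : CuspForm (Gamma0 N) 2)
    (κ : ZpExtension ℚ 2) (γ : absoluteGaloisGroup ℚ) (hκ : κ.IsCyclotomic),
    ¬ W.HasCM → IsOrdinaryAt W 2 → W.HasSurjectiveModNGaloisRep 2 → ¬ O1.TwoAdicSurjective W →
    κ.IsTopGenerator γ → IsCyclotomicVariable 2 γ → IsNewformOf W f →
    ∀ (D : W.SelmerDualData κ γ) (Y : W.FineSelmerDualData κ γ),
      ∃ (I : IwasawaH1Data W 2 κ γ) (K : DivisibilityInputs W 2 f κ γ I D)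
        (π : D.X →ₗ[IwasawaAlgebra 2] Y.X),
        Function.Surjective π ∧ Function.Exact K.toX π ∧
        K.Z ≤ Submodule.span (IwasawaAlgebra 2) {s : I.H | IsEulerSystemClassTwo W hκ I s}

/-- `CoreTheoremATwoResidue` unfolds to its displayed body. [folklore] -/
theorem coreTheoremATwoResidue_iff : CoreTheoremATwoResidue ↔
    ∀ (W : WeierstrassCurve ℚ) [W.IsElliptic] [W.IsGloballyMinimal]
      [ContinuousSMul ℤ_[2] (W.tateModule 2)] [Module.Free ℤ_[2] (W.tateModule 2)]
      [Module.Finite ℤ_[2] (W.tateModule 2)]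
      (κ : ZpExtension ℚ 2) (γ : absoluteGaloisGroup ℚ) (I : IwasawaH1Data W 2 κ γ)
      (hκ : κ.IsCyclotomic),
      W.HasGoodReductionAtPrime 2 → ¬ (2 : ℤ) ∣ W.frobeniusTrace 2 →
      W.HasSurjectiveModNGaloisRep 2 → W.Δ < 0 → κ.IsTopGenerator γ →
      (∃ s : I.H, IsEulerSystemClassTwo W hκ I s ∧
        s ∉ IwasawaAlgebra.augIdealP 2 • (⊤ : Submodule (IwasawaAlgebra 2) I.H)) →
      ∃ J : ℕ, ∀ y : Literature.NumberTheory.EllipticCurves.subgroupH1 κ.kerSubgroup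
          (WeierstrassCurve.geomTorsion W (2 : ℤ)),
        W.torsionToPrimaryH1Sub 2 κ.kerSubgroup y ∈ W.fineSelmerInfty κ →
          (⇑(Literature.NumberTheory.EllipticCurves.conjH1 κ.kerSubgroup
              (WeierstrassCurve.geomTorsion W (2 : ℤ)) γ -
            AddMonoidHom.id (Literature.NumberTheory.EllipticCurves.subgroupH1 κ.kerSubgroup
              (WeierstrassCurve.geomTorsion W (2 : ℤ)))))^[J] y = 0 :=
  Iff.rfl

/-- `DivisibilityInputsFineZetaAtTwoResidue` unfolds to its displayed body. [folklore] -/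
theorem divisibilityInputsFineZetaAtTwoResidue_iff : DivisibilityInputsFineZetaAtTwoResidue ↔
    ∀ (W : WeierstrassCurve ℚ) [W.IsElliptic] [W.IsGloballyMinimal]
      [ContinuousSMul ℤ_[2] (W.tateModule 2)] [Module.Free ℤ_[2] (W.tateModule 2)]
      [Module.Finite ℤ_[2] (W.tateModule 2)] {N : ℕ} [NeZero N] (f : CuspForm (Gamma0 N) 2)
      (κ : ZpExtension ℚ 2) (γ : absoluteGaloisGroup ℚ) (hκ : κ.IsCyclotomic),
      ¬ W.HasCM → IsOrdinaryAt W 2 → W.HasSurjectiveModNGaloisRep 2 → ¬ O1.TwoAdicSurjective W →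
      κ.IsTopGenerator γ → IsCyclotomicVariable 2 γ → IsNewformOf W f →
      ∀ (D : W.SelmerDualData κ γ) (Y : W.FineSelmerDualData κ γ),
        ∃ (I : IwasawaH1Data W 2 κ γ) (K : DivisibilityInputs W 2 f κ γ I D)
          (π : D.X →ₗ[IwasawaAlgebra 2] Y.X),
          Function.Surjective π ∧ Function.Exact K.toX π ∧
          K.Z ≤ Submodule.span (IwasawaAlgebra 2) {s : I.H | IsEulerSystemClassTwo W hκ I s} :=
  Iff.rfl

/-! ## §2 Kernel facts about the residue -/

section Residue

variable (W : WeierstrassCurve ℚ) [W.IsElliptic] [W.IsGloballyMinimal]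

omit [W.IsElliptic] [W.IsGloballyMinimal] in
/-- **On the residue the big-image hypothesis of `DivisibilityInputs.integral` is refutable**: if
`ρ_{W,2^∞}` is not onto then `¬ ∀ m, ρ̄_{W,2^m}` onto (`O1.TwoAdicSurjective W` is `∀ n > 0, ρ̄_{2^n}` onto, and the
field's hypothesis quantifies over all `m`). [folklore] -/
theorem integral_hypothesis_false_of_not_twoAdicSurjective (hns : ¬ O1.TwoAdicSurjective W) :
    ¬ ∀ m : ℕ, W.HasSurjectiveModNGaloisRep (2 ^ m : ℕ) := by
  intro h
  apply hns
  intro n _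
  have := h n
  push_cast at this
  exact this

/-- Dokchitser–Dokchitser on the residue: good ordinary at `2`, `ρ̄₂` onto, `ρ_{2^∞}` not onto ⇒ `−Δ ∈ ℚ^{×2}`
(at a good `2` the `2`-adic image is decided mod `8` = mod `4`, and mod `4` it is onto iff `ρ̄₂` onto and
`−Δ ∉ ℚ^{×2}`). [cite: DokchitserDokchitserMathZ2012, Theorem (1)–(3)] -/
theorem isSquare_neg_Δ_of_residue' (hgo : GoodOrd W 2) (h2 : W.HasSurjectiveModNGaloisRep 2)
    (hns : ¬ O1.TwoAdicSurjective W) : IsSquare (-W.Δ) := by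
  by_contra hsq
  apply hns
  rw [O1.twoAdicSurjective_iff_surjModEight]
  show W.HasSurjectiveModNGaloisRep 8
  rw [hasSurjectiveModNGaloisRep_eight_iff_four_of_good_two W hgo.1,
    hasSurjectiveModNGaloisRep_four_iff_of_goodOrd_two W hgo]
  exact ⟨h2, hsq⟩

/-- Hence `Δ < 0` on the residue. [cite: DokchitserDokchitserMathZ2012, Theorem (2)] -/
theorem Δ_neg_of_residue' (hgo : GoodOrd W 2) (h2 : W.HasSurjectiveModNGaloisRep 2)
    (hns : ¬ O1.TwoAdicSurjective W) : W.Δ < 0 := by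
  obtain ⟨r, hr⟩ := isSquare_neg_Δ_of_residue' W hgo h2 hns
  have hΔ : W.Δ ≠ 0 := W.isUnit_Δ.ne_zero
  have hr0 : r ≠ 0 := by
    rintro rfl
    exact hΔ (by linarith)
  have : 0 < r * r := mul_self_pos.mpr hr0
  linarith

end Residue

/-! ## §3 The kernel composition: sockets ⇒ `μ = 0` on the residue ⇒ the residue binder ⇒ the crux BY NAME -/

/-- **KERNEL modulo the two residue sockets: `μ(X(E/ℚ_∞)) = 0` for every cyclotomic Selmer dual datum of a
residue curve** — the verbatim `p = 2` twin of `X10.mu_eq_zero_of_coreOddPrime`: INT2-AUTO `L₂ = ι G₁` → socket 3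
(CLOSED, tree theorem p642753) `G₁ ∉ (2)` → socket 2 (package, span clause over `IsEulerSystemClassTwo`) +
`exists_mem_zeta_not_mem_of_mu_eq_zero` (§6 (i), generic `p`) + `exists_mem_not_mem_of_le_span` → a genuine
`2`-adic Euler-system class `∉ 2𝐇¹` → socket 1 → `Sel₀[2]`-lifts killed by `T^J` → `X₀/2X₀` finite →
`length_(2) X₀ = 0 = length_(2) X` (`lengthAt_X_le_lengthAt_fine`, generic `p`) → `D.mu = 0`. Conditional on the two
displayed binders; nothing else. [cite: Kato2004Asterisque, Thm. 12.6 (p. 222), (14.9.3) (p. 240), §17.13 (pp. 279–280)]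
[cite: MazurTateTeitelbaum1986Invent, §I.12] -/
theorem mu_eq_zero_on_residue_of_sockets (hport : CoreTheoremATwoResidue)
    (hF1 : DivisibilityInputsFineZetaAtTwoResidue) (W : WeierstrassCurve ℚ) [W.IsElliptic] [W.IsGloballyMinimal]
    (hcm : ¬ W.HasCM) (hgo : GoodOrd W 2) (h2 : W.HasSurjectiveModNGaloisRep 2)
    (hns : ¬ O1.TwoAdicSurjective W) {N : ℕ} [NeZero N] (f : CuspForm (Gamma0 N) 2)
    (hf : IsNewformOf W f) (κ : ZpExtension ℚ 2) (γ : absoluteGaloisGroup ℚ)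
    (hκ : κ.IsCyclotomic) (hγ : κ.IsTopGenerator γ) (hγ' : IsCyclotomicVariable 2 γ)
    (D : W.SelmerDualData κ γ) : D.mu = 0 := by
  haveI : ContinuousSMul ℤ_[2] (W.tateModule 2) := TateModule.continuousSMul_padicInt
  haveI : Module.Free ℤ_[2] (W.tateModule 2) := W.module_free_tateModule_holds 2
  haveI : Module.Finite ℤ_[2] (W.tateModule 2) := W.module_finite_tateModule_holds 2
  have hord : IsOrdinaryAt W 2 := ⟨hgo.1, hgo.2⟩
  have hΔ : W.Δ < 0 := Δ_neg_of_residue' W hgo h2 hns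
  haveI : NeZero ((2 : ℕ) : ℚ) := ⟨by norm_num⟩
  have hirr : W.HasIrreducibleModPGaloisRep 2 := hasIrreducibleModPGaloisRep_of_hasSurjectiveModNGaloisRep W 2 h2
  obtain ⟨Y⟩ := W.nonempty_fineSelmerDualData κ hγ
  -- `X(E/ℚ_∞)` is finitely generated over `Λ` for the cyclotomic `κ` (PROVED in the tree, Nakayama)
  haveI : Module.Finite (IwasawaAlgebra 2) D.X :=
    WeierstrassCurve.SelmerDualData.module_finite_of_isCyclotomic W κ hκ D hγ
  -- socket 2: Kato's package at 2 with the fine quotient and the span clause, `𝐇¹_Γ` bundled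
  obtain ⟨I, K, π, hπs, hπ, hZ⟩ := hF1 W f κ γ hκ hcm hord h2 hns hγ hγ' hf D Y
  haveI : Module.Finite (IwasawaAlgebra 2) Y.X := Module.Finite.of_surjective π hπs
  -- `L₂(f, α) ∈ ι(Λ)` (INT2-AUTO, PROVED) and socket 3 (CLOSED, tree theorem): `G₁ ∉ (2)`
  obtain ⟨G₁, hG₁⟩ := exists_iwasawaToPowerSeries_eq_padicLFunction_two_auto (W := W) (f := f) hord hf
  have hμL : G₁ ∉ IwasawaAlgebra.augIdealP 2 :=
    not_mem_augIdealP_of_norm_coeff_eq_one hG₁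
      (AnalyticMuTwo.analyticMuZeroFOnDD12Residue_shape W hcm hgo h2 hns f hf)
  -- §6 (i) (generic `p`): `μ(L₂) = 0` ⇒ some zeta class `z ∈ K.Z` is not divisible by `2` …
  obtain ⟨z, hz, hzp⟩ := exists_mem_zeta_not_mem_of_mu_eq_zero K hirr hG₁ hμL
  -- … and by the Thm 12.6 span clause some GENUINE `2`-adic Euler-system class is not divisible by `2`
  obtain ⟨s, hs, hsp⟩ := exists_mem_not_mem_of_le_span hZ hz hzp
  -- socket 1: a power of `T` kills the `E[2]`-lifts of `Sel₀`
  obtain ⟨J, hJ⟩ := hport W κ γ I hκ hgo.1 hgo.2 h2 hΔ hγ ⟨s, hs, hsp⟩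
  haveI : Finite (Y.X ⧸ (IwasawaAlgebra.augIdealP 2 • (⊤ : Submodule (IwasawaAlgebra 2) Y.X))) :=
    Y.finite_quotient_augIdealP_of_finite_pTorsion
      (W.finite_fineSelmerInfty_pTorsion_of_forall_iterate_eq_zero κ hγ hJ)
  -- bookkeeping at `𝔭 = (2)`: `length X₀_𝔭 = 0 ⟹ length X_𝔭 = 0 ⟹ μ(X) = 0`
  let 𝔭 : PrimeSpectrum (IwasawaAlgebra 2) :=
    ⟨IwasawaAlgebra.augIdealP 2, IwasawaAlgebra.isPrime_augIdealP_holds 2⟩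
  have hY0 : Module.lengthAt (IwasawaAlgebra 2) Y.X 𝔭 = 0 :=
    KatoMuSkeleton.lengthAt_eq_zero_of_finite_quotient_p (M := Y.X) 𝔭 rfl
  have hX0 : Module.lengthAt (IwasawaAlgebra 2) D.X 𝔭 = 0 :=
    le_antisymm ((lengthAt_X_le_lengthAt_fine K hirr hG₁ 𝔭
      (by exact IwasawaAlgebra.height_augIdealP_holds 2) hμL π hπ).trans hY0.le) bot_le
  change muInvariant 2 D.X = 0
  rw [muInvariant_eq_toNat_lengthAt 2 D.X 𝔭 rfl, hX0]
  rfl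

/-- **`O1.KatoMuPartAtTwo W` on the residue modulo the two sockets** (`μ = 0` ⇒ `2^{μ(X)} = 1 ∣ L₀`).
[cite: GreenbergLNM1716, Conj. 1.11 (p. 64) (shape)] -/
theorem katoMuPartAtTwo_on_residue_of_sockets (hport : CoreTheoremATwoResidue)
    (hF1 : DivisibilityInputsFineZetaAtTwoResidue) (W : WeierstrassCurve ℚ) [W.IsElliptic] [W.IsGloballyMinimal]
    (hcm : ¬ W.HasCM) (hgo : GoodOrd W 2) (h2 : W.HasSurjectiveModNGaloisRep 2)
    (hns : ¬ O1.TwoAdicSurjective W) : O1.KatoMuPartAtTwo W := by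
  intro κ γ hκ hγ hγ' _ _ f hf ϖ _ D L₀ _
  rw [mu_eq_zero_on_residue_of_sockets hport hF1 W hcm hgo h2 hns f hf κ γ hκ hγ hγ' D, pow_zero, map_one]
  exact one_dvd _

/-- **The residue binder `OrdKatoHalfDD12ResidueTwo` from the two sockets, Abbes–Ullmo BY NAME (socket 4, glue
p654400) and Kato 17.4 (1)(2) at `2` (`h17`, third conjunct of the route's PUB item 19149)** — through the cell's
`O1.mainConjectureLowerDivisibilityAtTwoOrd_of_katoMuPartAtTwo`. Conditional on the displayed binders.
[cite: Kato2004Asterisque, Thm. 17.4 (1)(2) (p. 273)] [cite: AbbesUllmo1996, Thm. A] -/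
theorem ordKatoHalfDD12ResidueTwo_of_sockets (hport : CoreTheoremATwoResidue)
    (hF1 : DivisibilityInputsFineZetaAtTwoResidue) (hAU : abbesUllmo_not_dvd_maninConstant_of_not_dvd_level)
    (h17 : ∀ (V : WeierstrassCurve ℚ) [V.IsElliptic] [V.IsGloballyMinimal] [NeZero (V.conductorNorm ℤ)]
      (f : CuspForm (Gamma0 (V.conductorNorm ℤ)) 2), kato_divisibility_allPrimes V 2 (f := f)) :
    OrdKatoHalfDD12ResidueTwo := by
  intro W _ _ hcm hgo h2 hns
  exact O1.mainConjectureLowerDivisibilityAtTwoOrd_of_katoMuPartAtTwo W (h17 W)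
    (hintOnDD12Residue_of_abbesUllmo hAU W hcm hgo h2 hns)
    (katoMuPartAtTwo_on_residue_of_sockets hport hF1 W hcm hgo h2 hns)

/-- **The crux `OrdKatoHalfAtTwoIso` (stmt-BirchSwinnertonDyer-19573) BY NAME from the line's binders**: socket 1
(research), socket 2 (memo), Abbes–Ullmo (print), B7, B8 (memo), Kato 17.4 (1)(2) at `2` (print) — one application of
the cell's door `ordKatoHalfAtTwoIso_of_binders`. This is the composition of the registered skeleton
`Lines/steinberg_fibre_at_two.lean` (v4) with its stubs as hypotheses; conditional, nothing closed.
[cite: Kato2004Asterisque, Thm. 17.4 (1)(2) (p. 273)] [cite: AbbesUllmo1996, Thm. A] -/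
theorem ordKatoHalfAtTwoIso_of_sockets (hport : CoreTheoremATwoResidue)
    (hF1 : DivisibilityInputsFineZetaAtTwoResidue) (hAU : abbesUllmo_not_dvd_maninConstant_of_not_dvd_level)
    (hB7 : KatoMuPartAtOptimalMemberOfNotSurjectiveTwo) (hB8 : KatoIntAtGoodOrdSurjectiveTwo)
    (h17 : ∀ (V : WeierstrassCurve ℚ) [V.IsElliptic] [V.IsGloballyMinimal] [NeZero (V.conductorNorm ℤ)]
      (f : CuspForm (Gamma0 (V.conductorNorm ℤ)) 2), kato_divisibility_allPrimes V 2 (f := f)) :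
    OrdKatoHalfAtTwoIso :=
  ordKatoHalfAtTwoIso_of_binders hB7 hB8 (ordKatoHalfDD12ResidueTwo_of_sockets hport hF1 hAU h17) h17

end Summit.BirchSwinnertonDyer.BirchSwinnertonDyer.Theorems.SteinbergFibreAtTwo

end
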